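import Mathlib
import Summits.KontsevichZagierPeriods.KontsevichZagierPeriods.Theorems.InverseLandauTateLiftingRotationSector
import Summits.KontsevichZagierPeriods.KontsevichZagierPeriods.Theorems.InverseLandauTateLiftingLowDimAlgSector
import Literature.NumberTheory.Transcendental.KZRulesAssociator
import Literature.NumberTheory.Transcendental.KZProductIdeal

/-!
# `TateLifting` (stmt-KontsevichZagierPeriods-9129), line `Sketch` — THE AREA OF THE SPHERE INSIDE
# THE RULES (stub 54 of the O(3) engine, continuation lead c9)

The honest stereographic chart representation `c = [ℝ², 4/(1+a²+b²)²]` of the area of the unit sphere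
`S²` (value `4π`) differs from `4·[disc]` by relations of the Kontsevich–Zagier calculus:
`tateLifting_sphereArea`. This is the common factor `4π` of the O(3) reduction of hard-sphere
configuration integrals, `[σ, 1] ≡ [ℝ², 4/(1+a²+b²)²]·[τ, ρ²]`, which the space kernel transfer cancels
against `4·[disc]`.

Proof (entirely inside the landed calculus):

* `c` is invariant under the rotations of its two coordinates, so the ROTATION REDUCTION
  `rotation_reduce` (rotation engine + Fubini splitting + `PiNormalisation`, with `n = 0`) gives an
  honest meridian `m = [(0, ∞), 8ρ/(1+ρ²)²]` with `[c] ≡ [m]·[disc]`;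
* the meridian has the RATIONAL value `∫₀^∞ 8ρ dρ/(1+ρ²)² = 4` (primitive `−4/(1+ρ²)`,
  `SphereChart.integral_Ioi_meridian`), so `[m] − 4·[pt, 1]` is a vanishing `ℤ`-combination of
  generators of the landed dimension-`≤ 1` algebraic sector and hence a relation
  (`kzKernelConjecture_lowDimAlg`, Baker inside the calculus — here only for a rational value);
* `KZ.relations` is a right ideal (`KZ.mul_mem_relations_right_holds`) and `[pt, 1]` is a left unit
  modulo relations (`KZ.of_unit_mul_sub_mem_relations`), whence
  `[c] − 4·[disc] = ([c] − [m]·[disc]) + ([m] − 4·[pt,1])·[disc] + 4·([pt,1]·[disc] − [disc])` is a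
  relation.

References: M. Kontsevich, D. Zagier, *Periods* (2001), §1.1 eq. (1), §1.2 (rules (1)–(3)), §4.1.
-/

noncomputable section

open MeasureTheory Set Filter Topology
open Literature.NumberTheory.Transcendental

namespace Summit.KontsevichZagierPeriods.InverseLandau

namespace SphereChart

/-- Coordinate `0` of the rotated point `(a·x₀ − b·x₁, b·x₀ + a·x₁)` in the binder shape of
`rotation_reduce` (`n = 0`). [folklore] -/
theorem rot_apply_zero (x : Fin 2 → ℝ) (A B : ℝ) :
    (Fin.snoc (Fin.snoc (Fin.init (Fin.init x : Fin 1 → ℝ) : Fin 0 → ℝ) A : Fin 1 → ℝ) B :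
      Fin 2 → ℝ) 0 = A := rfl

/-- Coordinate `1` of the rotated point `(a·x₀ − b·x₁, b·x₀ + a·x₁)` in the binder shape of
`rotation_reduce` (`n = 0`). [folklore] -/
theorem rot_apply_one (x : Fin 2 → ℝ) (A B : ℝ) :
    (Fin.snoc (Fin.snoc (Fin.init (Fin.init x : Fin 1 → ℝ) : Fin 0 → ℝ) A : Fin 1 → ℝ) B :
      Fin 2 → ℝ) 1 = B := rfl

/-- `(init x)(last 0) = x₀` on `ℝ²`. [folklore] -/
theorem init_apply_last_zero (x : Fin 2 → ℝ) : (Fin.init x : Fin 1 → ℝ) (Fin.last 0) = x 0 := rfl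

/-- `x (last 1) = x₁` on `ℝ²`. [folklore] -/
theorem apply_last_one (x : Fin 2 → ℝ) : x (Fin.last 1) = x 1 := rfl

/-- Transport `ℝ¹ → ℝ` of a set integral over the half-line `{ρ > 0}`
(`MeasurableEquiv.funUnique`, `volume_preserving_funUnique`). [folklore] -/
theorem setIntegral_fin_one_Ioi (g : ℝ → ℝ) :
    ∫ p in {p : Fin 1 → ℝ | 0 < p 0}, g (p 0) = ∫ ρ in Ioi (0 : ℝ), g ρ :=
  (volume_preserving_funUnique (Fin 1) ℝ).setIntegral_preimage_emb
    (MeasurableEquiv.funUnique (Fin 1) ℝ).measurableEmbedding g (Ioi 0)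

/-- **The meridian of the sphere has the rational value `4`**: `∫₀^∞ 8ρ dρ/(1+ρ²)² = 4`
(primitive `−4/(1+ρ²)`, FTC on the half-line `integral_Ioi_of_hasDerivAt_of_nonneg'`). [folklore] -/
theorem integral_Ioi_meridian : ∫ ρ in Ioi (0 : ℝ), 8 * ρ / (1 + ρ ^ 2) ^ 2 = 4 := by
  have hderiv : ∀ ρ ∈ Ici (0 : ℝ),
      HasDerivAt (fun ρ : ℝ => -4 * (1 + ρ ^ 2)⁻¹) (8 * ρ / (1 + ρ ^ 2) ^ 2) ρ := by
    intro ρ _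
    have h1 : HasDerivAt (fun ρ : ℝ => 1 + ρ ^ 2) (2 * ρ) ρ :=
      ((hasDerivAt_pow 2 ρ).const_add 1).congr_deriv (by norm_num)
    have hne : (1 + ρ ^ 2 : ℝ) ≠ 0 := by positivity
    exact ((h1.inv hne).const_mul (-4 : ℝ)).congr_deriv (by ring)
  have hpos : ∀ ρ ∈ Ioi (0 : ℝ), 0 ≤ 8 * ρ / (1 + ρ ^ 2) ^ 2 := fun ρ hρ => by
    have hρ' : (0 : ℝ) < ρ := hρ
    positivity
  have hlim : Tendsto (fun ρ : ℝ => -4 * (1 + ρ ^ 2)⁻¹) atTop (𝓝 0) := by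
    have h : Tendsto (fun ρ : ℝ => 1 + ρ ^ 2) atTop atTop :=
      tendsto_atTop_add_const_left _ _ (tendsto_pow_atTop two_ne_zero)
    simpa using (tendsto_inv_atTop_zero.comp h).const_mul (-4 : ℝ)
  rw [integral_Ioi_of_hasDerivAt_of_nonneg' hderiv hpos hlim]
  norm_num

/-- The image in `ℝ[X]` of a rational polynomial has `ℚ`-algebraic coefficients. [folklore] -/
theorem isAlgebraic_coeff_map (f : Polynomial ℚ) (i : ℕ) :
    IsAlgebraic ℚ ((f.map (algebraMap ℚ ℝ)).coeff i) := by
  rw [Polynomial.coeff_map]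
  exact isAlgebraic_algebraMap _

/-- Evaluation of the numerator `8X` of the meridian integrand. [folklore] -/
theorem eval_num (t : ℝ) :
    ((Polynomial.C 8 * Polynomial.X : Polynomial ℚ).map (algebraMap ℚ ℝ)).eval t = 8 * t := by
  simp

/-- Evaluation of the denominator `(1 + X²)²` of the meridian integrand. [folklore] -/
theorem eval_den (t : ℝ) :
    (((1 + Polynomial.X ^ 2) ^ 2 : Polynomial ℚ).map (algebraMap ℚ ℝ)).eval t = (1 + t ^ 2) ^ 2 := by
  simp

end SphereChart

open SphereChart

/-- **THE AREA OF THE SPHERE INSIDE THE RULES** (stub 54 of line `Sketch`, crux `TateLifting`): the honest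
stereographic chart representation `[ℝ², 4/(1+a²+b²)²]` of `area(S²) = 4π` differs by relations of the
Kontsevich–Zagier calculus from `4·[disc]`. It is invariant under the rotations of its two coordinates, so
the rotation reduction `rotation_reduce` gives `[ℝ², 4/(1+a²+b²)²] ≡ [m]·[disc]` with the honest meridian
`m = [(0,∞), 8ρ/(1+ρ²)²]` of rational value `4`; `[m] − 4·[pt,1]` is then a relation by the landed
dimension-`≤ 1` algebraic sector `kzKernelConjecture_lowDimAlg`, and the right-ideal property of
`KZ.relations` with the unit `[pt,1]` of the Fubini product concludes.
[cite: KontsevichZagier2001, §1.2] -/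
theorem tateLifting_sphereArea :
    ∀ c : KZ.IntegralRep 2, c.domain = Set.univ →
      (c.integrand = fun u => 4 / (1 + u 0 ^ 2 + u 1 ^ 2) ^ 2) →
      KZ.of c - (4 : ℤ) • KZ.of KZ.piRep ∈ KZ.relations := by
  intro c hcd hci
  -- Step 1: rotation invariance of `c` and the honest meridian (`rotation_reduce`, `n = 0`)
  have hinv : ∀ x ∈ c.domain, ∀ a b : ℝ, a ^ 2 + b ^ 2 = 1 →
      (Fin.snoc (Fin.snoc (Fin.init (Fin.init x : Fin 1 → ℝ) : Fin 0 → ℝ)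
          (a * (Fin.init x : Fin 1 → ℝ) (Fin.last 0) - b * x (Fin.last 1)) : Fin 1 → ℝ)
          (b * (Fin.init x : Fin 1 → ℝ) (Fin.last 0) + a * x (Fin.last 1)) : Fin 2 → ℝ) ∈ c.domain ∧
      c.integrand (Fin.snoc (Fin.snoc (Fin.init (Fin.init x : Fin 1 → ℝ) : Fin 0 → ℝ)
          (a * (Fin.init x : Fin 1 → ℝ) (Fin.last 0) - b * x (Fin.last 1)) : Fin 1 → ℝ)
          (b * (Fin.init x : Fin 1 → ℝ) (Fin.last 0) + a * x (Fin.last 1)) : Fin 2 → ℝ) =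
        c.integrand x := by
    intro x _ a b hab
    refine ⟨by rw [hcd]; exact Set.mem_univ _, ?_⟩
    have key : (a * x 0 - b * x 1) ^ 2 + (b * x 0 + a * x 1) ^ 2 = x 0 ^ 2 + x 1 ^ 2 := by
      linear_combination (x 0 ^ 2 + x 1 ^ 2) * hab
    simp only [hci, rot_apply_zero, rot_apply_one, init_apply_last_zero, apply_last_one]
    rw [add_assoc, key, ← add_assoc]
  obtain ⟨m, hmd, hmi, hred⟩ : ∃ m : KZ.IntegralRep 1,
      m.domain = {p | 0 < p (Fin.last 0) ∧ (Fin.snoc p 0 : Fin 2 → ℝ) ∈ c.domain} ∧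
      (m.integrand = fun p => 2 * p (Fin.last 0) * c.integrand (Fin.snoc p 0 : Fin 2 → ℝ)) ∧
      KZ.of c - KZ.of m * KZ.of KZ.piRep ∈ KZ.relations :=
    rotation_reduce (n := 0) c hinv
  have hmd' : m.domain = {p : Fin 1 → ℝ | 0 < p 0} := by
    rw [hmd, hcd]
    ext p
    simp only [Set.mem_setOf_eq, Set.mem_univ, and_true, Fin.last_zero]
  have hmi' : m.integrand = fun p => 8 * p 0 / (1 + p 0 ^ 2) ^ 2 := by
    -- `(p, 0)₀ = p₀` and `(p, 0)₁ = 0` on `ℝ¹ × ℝ = ℝ²`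
    have e0 : ∀ (v : Fin 1 → ℝ) (t : ℝ), (Fin.snoc v t : Fin 2 → ℝ) 0 = v 0 := fun _ _ => rfl
    have e1 : ∀ (v : Fin 1 → ℝ) (t : ℝ), (Fin.snoc v t : Fin 2 → ℝ) 1 = t := fun _ _ => rfl
    rw [hmi, hci]
    funext p
    simp only [Fin.last_zero, e0, e1]
    ring
  -- Step 2: the meridian has the rational value `4`
  have hval : m.value = 4 := by
    rw [KZ.IntegralRep.value, hmd', hmi']
    exact (setIntegral_fin_one_Ioi (fun ρ => 8 * ρ / (1 + ρ ^ 2) ^ 2)).trans integral_Ioi_meridian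
  -- Step 3: `[m] − 4·[pt, 1]` is a relation (dimension ≤ 1, algebraic coefficients)
  have hm : KZ.of m ∈ AddSubgroup.closure
      {d : KZ.FormalRep | (∃ r : KZ.IntegralRep 0, d = KZ.of r) ∨
        ∃ (r : KZ.IntegralRep 1) (p q : Polynomial ℝ), (∀ i, IsAlgebraic ℚ (p.coeff i)) ∧
          (∀ i, IsAlgebraic ℚ (q.coeff i)) ∧ (∀ x ∈ r.domain, q.eval (x 0) ≠ 0) ∧
          Set.EqOn r.integrand (fun x => p.eval (x 0) / q.eval (x 0)) r.domain ∧ d = KZ.of r} := by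
    refine AddSubgroup.subset_closure (Or.inr ⟨m,
      (Polynomial.C 8 * Polynomial.X : Polynomial ℚ).map (algebraMap ℚ ℝ),
      ((1 + Polynomial.X ^ 2) ^ 2 : Polynomial ℚ).map (algebraMap ℚ ℝ),
      isAlgebraic_coeff_map _, isAlgebraic_coeff_map _, fun x _ => ?_, fun x _ => ?_, rfl⟩)
    · rw [eval_den]; positivity
    · simp only [hmi', eval_num, eval_den]
  have hu : KZ.of KZ.IntegralRep.unit ∈ AddSubgroup.closure
      {d : KZ.FormalRep | (∃ r : KZ.IntegralRep 0, d = KZ.of r) ∨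
        ∃ (r : KZ.IntegralRep 1) (p q : Polynomial ℝ), (∀ i, IsAlgebraic ℚ (p.coeff i)) ∧
          (∀ i, IsAlgebraic ℚ (q.coeff i)) ∧ (∀ x ∈ r.domain, q.eval (x 0) ≠ 0) ∧
          Set.EqOn r.integrand (fun x => p.eval (x 0) / q.eval (x 0)) r.domain ∧ d = KZ.of r} :=
    AddSubgroup.subset_closure (Or.inl ⟨KZ.IntegralRep.unit, rfl⟩)
  have hm4 : KZ.of m - (4 : ℤ) • KZ.of KZ.IntegralRep.unit ∈ KZ.relations := by
    refine kzKernelConjecture_lowDimAlg _ (AddSubgroup.sub_mem _ hm (AddSubgroup.zsmul_mem _ hu 4)) ?_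
    rw [map_sub, map_zsmul, KZ.eval_of, KZ.eval_of, hval, KZ.IntegralRep.value_unit]
    norm_num
  -- Step 4: right ideal + left unit modulo relations
  have h2 : (KZ.of m - (4 : ℤ) • KZ.of KZ.IntegralRep.unit) * KZ.of KZ.piRep ∈ KZ.relations :=
    KZ.mul_mem_relations_right_holds _ _ hm4
  have h3 : (4 : ℤ) • (KZ.of KZ.IntegralRep.unit * KZ.of KZ.piRep - KZ.of KZ.piRep) ∈ KZ.relations :=
    KZ.relations.zsmul_mem (KZ.of_unit_mul_sub_mem_relations _) _
  have hsum : KZ.of c - (4 : ℤ) • KZ.of KZ.piRep = (KZ.of c - KZ.of m * KZ.of KZ.piRep) +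
      (KZ.of m - (4 : ℤ) • KZ.of KZ.IntegralRep.unit) * KZ.of KZ.piRep +
      (4 : ℤ) • (KZ.of KZ.IntegralRep.unit * KZ.of KZ.piRep - KZ.of KZ.piRep) := by
    rw [sub_mul, smul_mul_assoc, smul_sub]
    abel
  rw [hsum]
  exact KZ.relations.add_mem (KZ.relations.add_mem hred h2) h3

end Summit.KontsevichZagierPeriods.InverseLandau

end
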